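import Literature.NumberTheory.LFunctions.EulerLogRemainder
import HarnessLib

/-!
# Euler products with finitely many shifted zeta-power singularities: `Π_{n ∈ S} ζ(s − in)^{μ_n} · e^{E(s)}`

Topic `Literature/NumberTheory/LFunctions` (T-ANT), family RH. Everything here is PROVED; the file has
definitions (the singular product, its cofactor, the continuation) and no named facts.

Setting (Montgomery 1983, §3: "we write `f*(s) = Π_k ζ(s−ik)^{b̂(k)}` … `f(s) = f₁(s) f₃(s)`"). Let
`f : ℕ →*₀ ℂ` be completely multiplicative with `‖f‖ ≤ 1`, and suppose that on `Re s > 1` its prime sum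
splits as
  `Σ_p f(p) p^{−s} = Σ_{n ∈ S} μ_n Σ_p p^{in−s} + A(s)`      (`S ⊆ ℤ` finite, `μ_n` real)
with `A` holomorphic on a right half-plane `Re s > σ_A` (`σ_A < 1`). Then, with the tree's branch
`zetaCpow μ` of `ζ^μ` on the classical region slit along `(−∞, 1]`
(`LogZetaClassicalRegion.lean`) and the bounded second-order Euler terms `logRemainder`
(`EulerLogRemainder.lean`):

* `shiftedZetaCpowProd S μ s = Π_{n ∈ S} zetaCpow (μ n) (s − in)` is holomorphic on
  `shiftedSlitDomain S = ⋂_n (slit region + in)` (`differentiableOn_shiftedZetaCpowProd`), equals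
  `exp(Σ_n μ_n Σ_p −Log(1 − p^{in−s}))` for `Re s > 1` (`shiftedZetaCpowProd_eq_exp`) and has the
  branch-free modulus `Π_n ‖ζ(s − in)‖^{μ_n}` (`norm_shiftedZetaCpowProd`);
* `eulerContinuation f S μ A s = shiftedZetaCpowProd S μ s · exp(E(s))`,
  `E(s) = −Σ_n μ_n logRemainder 1 (s − in) + A(s) + logRemainder f s`, is holomorphic on
  `shiftedSlitDomain S ∩ {Re s > 3/4} ∩ {Re s > σ_A}` (`differentiableOn_eulerContinuation`) and
  **continues the Dirichlet series**: `Σ_n f(n) n^{−s} = eulerContinuation f S μ A s` for `Re s > 1`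
  (`LSeries_eq_eulerContinuation`);
* the modulus bound `‖eulerContinuation … s‖ ≤ Π_n ‖ζ(s − in)‖^{μ_n} · exp((1 + Σ_n|μ_n|) R* + ‖A(s)‖)`,
  `R* = (5/4) Σ_p p^{−3/2}` (`norm_eulerContinuation_le`);
* the local structure at a branch point `1 + ik`, `k ∈ S`:
  `eulerContinuation … s = zetaCpow (μ k) (s − ik) · cofactor … k s` with the cofactor holomorphic
  (and non-zero) wherever the OTHER factors are (`eulerContinuation_eq_zetaCpow_mul_cofactor`,
  `differentiableOn_cofactor`, `cofactor_ne_zero`).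

This is the analytic continuation "(21)" needed for the contour argument of Montgomery's §4, in the
variant with finitely many singularities (the dithered twist of
`Literature/Barriers/RiemannHypothesis/TuranPartialSumsDitheredTwist.lean`).

## References

* [Montgomery1983] H. L. Montgomery, *Zeros of approximations to the zeta function* (1983), §3
  (`f*`, `f = f₁ f₂ f₃`, Lemmas 2–4), §4 (21).
* [Tenenbaum2015] G. Tenenbaum, *Introduction to analytic and probabilistic number theory*, 3rd ed.,
  II.5 §5.1 (products `G(s) ζ(s)^{z}`).
-/

noncomputable section

open Complex Set Filter Topology

namespace Literature.NumberTheory.LFunctions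

variable (S : Finset ℤ) (μ : ℤ → ℝ)

/-! ### The singular product -/

/-- The domain of the singular product: `⋂_{n ∈ S} (zfrSlitRegion + in)`. [folklore] -/
def shiftedSlitDomain : Set ℂ := {s : ℂ | ∀ n ∈ S, s - n * I ∈ zfrSlitRegion}

/-- The domain is open. [folklore] -/
theorem isOpen_shiftedSlitDomain : IsOpen (shiftedSlitDomain S) := by
  have : shiftedSlitDomain S = ⋂ n ∈ S, (fun s : ℂ ↦ s - n * I) ⁻¹' zfrSlitRegion := by
    ext s; simp [shiftedSlitDomain]
  rw [this]
  exact isOpen_biInter_finset fun n _ ↦ isOpen_zfrSlitRegion.preimage (by fun_prop)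

/-- The half-plane `Re s > 1` lies in the domain. [folklore] -/
theorem mem_shiftedSlitDomain_of_one_lt_re {s : ℂ} (hs : 1 < s.re) : s ∈ shiftedSlitDomain S :=
  fun n _ ↦ mem_zfrSlitRegion_of_one_lt_re (by simpa using hs)

/-- **The singular product** `Z(s) = Π_{n ∈ S} ζ(s − in)^{μ_n}` (branches `zetaCpow`).
[cite: Montgomery1983, §3 (f*(s))] -/
def shiftedZetaCpowProd (s : ℂ) : ℂ := ∏ n ∈ S, zetaCpow (μ n) (s - n * I)

/-- `Z` is holomorphic on the domain. [folklore] -/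
theorem differentiableOn_shiftedZetaCpowProd :
    DifferentiableOn ℂ (shiftedZetaCpowProd S μ) (shiftedSlitDomain S) := by
  unfold shiftedZetaCpowProd
  refine DifferentiableOn.fun_finsetProd (𝕜 := ℂ) (𝔸' := ℂ)
    (f := fun (n : ℤ) (s : ℂ) ↦ zetaCpow (μ n) (s - n * I)) fun n hn ↦ ?_
  intro s hs
  have h1 : DifferentiableAt ℂ (fun s : ℂ ↦ s - n * I) s := by fun_prop
  have h2 : DifferentiableAt ℂ (zetaCpow (μ n)) (s - n * I) :=
    (differentiableOn_zetaCpow (μ n)).differentiableAt (isOpen_zfrSlitRegion.mem_nhds (hs n hn))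
  exact (h2.comp s h1).differentiableWithinAt

/-- On `Re s > 1`: `Z(s) = exp(Σ_{n ∈ S} μ_n · Σ_p −Log(1 − p^{in−s}))`. [cite: Montgomery1983, §3 (21)] -/
theorem shiftedZetaCpowProd_eq_exp {s : ℂ} (hs : 1 < s.re) :
    shiftedZetaCpowProd S μ s = exp (∑ n ∈ S, (μ n : ℂ) * eulerLogZeta (s - n * I)) := by
  rw [exp_sum, shiftedZetaCpowProd]
  refine Finset.prod_congr rfl fun n _ ↦ ?_
  exact zetaCpow_eq_exp_eulerLogZeta (by simpa using hs)

/-- **Branch-free modulus**: `‖Z(s)‖ = Π_n ‖ζ(s − in)‖^{μ_n}` when every `s − in` lies in the region and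
is `≠ 1`. [folklore] -/
theorem norm_shiftedZetaCpowProd {s : ℂ} (hs : ∀ n ∈ S, s - n * I ∈ zfrRegion)
    (hs1 : ∀ n ∈ S, s - n * I ≠ 1) :
    ‖shiftedZetaCpowProd S μ s‖ = ∏ n ∈ S, ‖riemannZeta (s - n * I)‖ ^ (μ n) := by
  rw [shiftedZetaCpowProd, norm_prod]
  exact Finset.prod_congr rfl fun n hn ↦ norm_zetaCpow (hs n hn) (hs1 n hn)

/-- `Z(s) ≠ 0` off the branch points. [folklore] -/
theorem shiftedZetaCpowProd_ne_zero {s : ℂ} (hs1 : ∀ n ∈ S, s - n * I ≠ 1) :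
    shiftedZetaCpowProd S μ s ≠ 0 := by
  rw [shiftedZetaCpowProd]
  exact Finset.prod_ne_zero_iff.2 fun n hn ↦ zetaCpow_ne_zero (μ n) (hs1 n hn)

/-! ### The continuation of `Σ f(n) n^{-s}` -/

variable (f : ℕ →*₀ ℂ) (A : ℂ → ℂ)

/-- The exponent `E(s) = −Σ_n μ_n logRemainder 1 (s − in) + A(s) + logRemainder f s` of the harmless
factor. [cite: Montgomery1983, §3 (15)–(16)] -/
def harmlessExponent (s : ℂ) : ℂ :=
  -(∑ n ∈ S, (μ n : ℂ) * logRemainder (fun _ ↦ 1) (s - n * I)) + A s + logRemainder (f ·) s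

/-- **The continuation** `G(s) = Z(s) · exp(E(s))`. [cite: Montgomery1983, §3 (21)] -/
def eulerContinuation (s : ℂ) : ℂ :=
  shiftedZetaCpowProd S μ s * exp (harmlessExponent S μ f A s)

variable {S μ f A}

/-- The harmless exponent is holomorphic on `{Re s > 3/4} ∩ {Re s > σ_A}`. [folklore] -/
theorem differentiableOn_harmlessExponent (hf : ∀ n, ‖f n‖ ≤ 1) {σA : ℝ}
    (hA : DifferentiableOn ℂ A {s : ℂ | σA < s.re}) :
    DifferentiableOn ℂ (harmlessExponent S μ f A) ({s : ℂ | 3 / 4 < s.re} ∩ {s : ℂ | σA < s.re}) := by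
  have hU : IsOpen ({s : ℂ | 3 / 4 < s.re} ∩ {s : ℂ | σA < s.re}) :=
    (isOpen_lt continuous_const continuous_re).inter (isOpen_lt continuous_const continuous_re)
  intro s hs
  have h34 : 3 / 4 < s.re := hs.1
  -- the shifted remainders
  have hR : ∀ n ∈ S, DifferentiableAt ℂ (fun s : ℂ ↦ logRemainder (fun _ ↦ (1 : ℂ)) (s - n * I)) s := by
    intro n _
    have h1 : DifferentiableAt ℂ (fun s : ℂ ↦ s - n * I) s := by fun_prop
    have h2 : DifferentiableAt ℂ (logRemainder (fun _ ↦ (1 : ℂ))) (s - n * I) :=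
      (differentiableOn_logRemainder (c := fun _ ↦ (1 : ℂ)) (fun _ ↦ by simp)).differentiableAt
        ((isOpen_lt continuous_const continuous_re).mem_nhds (by simpa using h34))
    exact h2.comp s h1
  have hsum : DifferentiableAt ℂ (fun s : ℂ ↦ ∑ n ∈ S, (μ n : ℂ) * logRemainder (fun _ ↦ 1) (s - n * I)) s :=
    DifferentiableAt.fun_sum fun n hn ↦ (hR n hn).const_mul _
  have hAs : DifferentiableAt ℂ A s :=
    hA.differentiableAt ((isOpen_lt continuous_const continuous_re).mem_nhds hs.2)
  have hRf : DifferentiableAt ℂ (logRemainder (f ·)) s :=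
    (differentiableOn_logRemainder (c := (f ·)) hf).differentiableAt
      ((isOpen_lt continuous_const continuous_re).mem_nhds h34)
  exact ((hsum.neg.add hAs).add hRf).differentiableWithinAt

/-- **Holomorphy of the continuation** on `shiftedSlitDomain S ∩ {Re s > 3/4} ∩ {Re s > σ_A}`.
[cite: Montgomery1983, §3 (21)] -/
theorem differentiableOn_eulerContinuation (hf : ∀ n, ‖f n‖ ≤ 1) {σA : ℝ}
    (hA : DifferentiableOn ℂ A {s : ℂ | σA < s.re}) :
    DifferentiableOn ℂ (eulerContinuation S μ f A)
      (shiftedSlitDomain S ∩ ({s : ℂ | 3 / 4 < s.re} ∩ {s : ℂ | σA < s.re})) := by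
  unfold eulerContinuation
  exact ((differentiableOn_shiftedZetaCpowProd S μ).mono inter_subset_left).mul
    (((differentiableOn_harmlessExponent hf hA).mono inter_subset_right).cexp)

/-- **The continuation continues the Dirichlet series.** If `‖f‖ ≤ 1` and the prime sum splits as
`Σ_p f(p)p^{−s} = Σ_{n ∈ S} μ_n Σ_p p^{in−s} + A(s)` on `Re s > 1`, then
`Σ_n f(n) n^{−s} = eulerContinuation f S μ A s` for `Re s > 1`.
[cite: Montgomery1983, §3 (15)–(16) and (21)] -/
theorem LSeries_eq_eulerContinuation (hf : ∀ n, ‖f n‖ ≤ 1)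
    (hsplit : ∀ s : ℂ, 1 < s.re → (∑' p : Nat.Primes, f p * (p : ℂ) ^ (-s)) =
      (∑ n ∈ S, (μ n : ℂ) * ∑' p : Nat.Primes, (p : ℂ) ^ (-(s - n * I))) + A s)
    {s : ℂ} (hs : 1 < s.re) :
    LSeries (f ·) s = eulerContinuation S μ f A s := by
  rw [LSeries_eq_exp_primeSum_add_logRemainder f hf hs, hsplit s hs, eulerContinuation,
    shiftedZetaCpowProd_eq_exp S μ hs, ← exp_add, harmlessExponent]
  congr 1
  -- `Σ_n μ_n P(s − in) = Σ_n μ_n (eulerLogZeta (s − in) − logRemainder 1 (s − in))`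
  have hP : ∀ n ∈ S, (∑' p : Nat.Primes, (p : ℂ) ^ (-(s - n * I))) =
      eulerLogZeta (s - n * I) - logRemainder (fun _ ↦ 1) (s - n * I) := by
    intro n _
    rw [eulerLogZeta_eq_primeZeta_add_logRemainder (by simpa using hs)]
    ring
  rw [Finset.sum_congr rfl fun n hn ↦ by rw [hP n hn]]
  simp only [mul_sub, Finset.sum_sub_distrib]
  ring


/-! ### Bounds -/

/-- The absolute constant `R* = (5/4) Σ_p p^{−3/2}` bounding every `logRemainder` on `Re s ≥ 3/4`.
[folklore] -/
def logRemainderBound : ℝ := 5 / 4 * ∑' p : Nat.Primes, (p : ℝ) ^ (-(3 / 2 : ℝ))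

/-- `0 ≤ R*`. [folklore] -/
theorem logRemainderBound_nonneg : 0 ≤ logRemainderBound :=
  mul_nonneg (by norm_num) (tsum_nonneg fun p ↦ Real.rpow_nonneg (Nat.cast_nonneg _) _)

/-- **Bound for the harmless exponent**: `‖E(s)‖ ≤ (1 + Σ_n |μ_n|) R* + ‖A(s)‖` for `Re s ≥ 3/4`.
[cite: Montgomery1983, §3 (16)] -/
theorem norm_harmlessExponent_le (hf : ∀ n, ‖f n‖ ≤ 1) {s : ℂ} (hs : 3 / 4 ≤ s.re) :
    ‖harmlessExponent S μ f A s‖ ≤ (1 + ∑ n ∈ S, |μ n|) * logRemainderBound + ‖A s‖ := by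
  unfold harmlessExponent
  have h1 : ‖-(∑ n ∈ S, (μ n : ℂ) * logRemainder (fun _ ↦ 1) (s - n * I))‖ ≤
      (∑ n ∈ S, |μ n|) * logRemainderBound := by
    rw [norm_neg, Finset.sum_mul]
    refine (norm_sum_le _ _).trans (Finset.sum_le_sum fun n _ ↦ ?_)
    rw [norm_mul, norm_real, Real.norm_eq_abs]
    exact mul_le_mul_of_nonneg_left
      (norm_logRemainder_le (c := fun _ ↦ (1 : ℂ)) (fun _ ↦ by simp) (by simpa using hs)) (abs_nonneg _)
  have h2 : ‖logRemainder (f ·) s‖ ≤ logRemainderBound := norm_logRemainder_le hf hs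
  calc ‖-(∑ n ∈ S, (μ n : ℂ) * logRemainder (fun _ ↦ 1) (s - n * I)) + A s + logRemainder (f ·) s‖
      ≤ ‖-(∑ n ∈ S, (μ n : ℂ) * logRemainder (fun _ ↦ 1) (s - n * I))‖ + ‖A s‖ + ‖logRemainder (f ·) s‖ :=
        norm_add₃_le
    _ ≤ (∑ n ∈ S, |μ n|) * logRemainderBound + ‖A s‖ + logRemainderBound := by linarith
    _ = (1 + ∑ n ∈ S, |μ n|) * logRemainderBound + ‖A s‖ := by ring

/-- **Modulus of the continuation**:
`‖G(s)‖ ≤ (Π_n ‖ζ(s − in)‖^{μ_n}) · exp((1 + Σ_n |μ_n|) R* + ‖A(s)‖)` off the branch points.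
[cite: Montgomery1983, §3 (Lemmas 2–3)] -/
theorem norm_eulerContinuation_le (hf : ∀ n, ‖f n‖ ≤ 1) {s : ℂ} (hs34 : 3 / 4 ≤ s.re)
    (hs : ∀ n ∈ S, s - n * I ∈ zfrRegion) (hs1 : ∀ n ∈ S, s - n * I ≠ 1) :
    ‖eulerContinuation S μ f A s‖ ≤
      (∏ n ∈ S, ‖riemannZeta (s - n * I)‖ ^ (μ n)) *
        Real.exp ((1 + ∑ n ∈ S, |μ n|) * logRemainderBound + ‖A s‖) := by
  rw [eulerContinuation, norm_mul, norm_shiftedZetaCpowProd S μ hs hs1, norm_exp]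
  refine mul_le_mul_of_nonneg_left ?_ (Finset.prod_nonneg fun n _ ↦ Real.rpow_nonneg (norm_nonneg _) _)
  exact Real.exp_le_exp.2 ((re_le_norm _).trans (norm_harmlessExponent_le hf hs34))

/-- `G(s) ≠ 0` off the branch points. [folklore] -/
theorem eulerContinuation_ne_zero {s : ℂ} (hs1 : ∀ n ∈ S, s - n * I ≠ 1) :
    eulerContinuation S μ f A s ≠ 0 :=
  mul_ne_zero (shiftedZetaCpowProd_ne_zero S μ hs1) (exp_ne_zero _)

/-! ### Local structure at a branch point -/

variable (S μ f A)

/-- The cofactor of the `k`-th singularity: `H_k(s) = Π_{n ∈ S, n ≠ k} ζ(s − in)^{μ_n} · exp(E(s))`.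
[cite: Montgomery1983, §4 (the loops Γ_k)] -/
def cofactor (k : ℤ) (s : ℂ) : ℂ :=
  (∏ n ∈ S.erase k, zetaCpow (μ n) (s - n * I)) * exp (harmlessExponent S μ f A s)

variable {S μ f A}

/-- `G(s) = ζ(s − ik)^{μ_k} · H_k(s)` for `k ∈ S`. [folklore] -/
theorem eulerContinuation_eq_zetaCpow_mul_cofactor {k : ℤ} (hk : k ∈ S) (s : ℂ) :
    eulerContinuation S μ f A s = zetaCpow (μ k) (s - k * I) * cofactor S μ f A k s := by
  rw [eulerContinuation, cofactor, shiftedZetaCpowProd, ← Finset.mul_prod_erase _ _ hk, mul_assoc]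

/-- The cofactor is holomorphic wherever the other factors are:
on `{s | ∀ n ∈ S, n ≠ k → s − in ∈ zfrSlitRegion} ∩ {Re s > 3/4} ∩ {Re s > σ_A}`. [folklore] -/
theorem differentiableOn_cofactor (hf : ∀ n, ‖f n‖ ≤ 1) {σA : ℝ}
    (hA : DifferentiableOn ℂ A {s : ℂ | σA < s.re}) (k : ℤ) :
    DifferentiableOn ℂ (cofactor S μ f A k)
      ({s : ℂ | ∀ n ∈ S, n ≠ k → s - n * I ∈ zfrSlitRegion} ∩
        ({s : ℂ | 3 / 4 < s.re} ∩ {s : ℂ | σA < s.re})) := by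
  unfold cofactor
  refine DifferentiableOn.mul ?_ (((differentiableOn_harmlessExponent hf hA).mono inter_subset_right).cexp)
  refine (DifferentiableOn.fun_finsetProd (𝕜 := ℂ) (𝔸' := ℂ)
    (f := fun (n : ℤ) (s : ℂ) ↦ zetaCpow (μ n) (s - n * I)) fun n hn ↦ ?_).mono inter_subset_left
  intro s hs
  have hnk : n ≠ k := Finset.ne_of_mem_erase hn
  have hnS : n ∈ S := Finset.mem_of_mem_erase hn
  have h1 : DifferentiableAt ℂ (fun s : ℂ ↦ s - n * I) s := by fun_prop
  have h2 : DifferentiableAt ℂ (zetaCpow (μ n)) (s - n * I) :=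
    (differentiableOn_zetaCpow (μ n)).differentiableAt (isOpen_zfrSlitRegion.mem_nhds (hs n hnS hnk))
  exact (h2.comp s h1).differentiableWithinAt

/-- The cofactor does not vanish off the other branch points. [folklore] -/
theorem cofactor_ne_zero {k : ℤ} {s : ℂ} (hs1 : ∀ n ∈ S, n ≠ k → s - n * I ≠ 1) :
    cofactor S μ f A k s ≠ 0 := by
  refine mul_ne_zero (Finset.prod_ne_zero_iff.2 fun n hn ↦ ?_) (exp_ne_zero _)
  exact zetaCpow_ne_zero (μ n) (hs1 n (Finset.mem_of_mem_erase hn) (Finset.ne_of_mem_erase hn))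

/-- At the branch point `1 + ik` itself the other factors are regular: `1 + ik − in` has nonzero
imaginary part for `n ≠ k`, hence lies in the slit region. [folklore] -/
theorem branchPoint_mem_cofactorDomain {k : ℤ} :
    ∀ n ∈ S, n ≠ k → (1 + k * I : ℂ) - n * I ∈ zfrSlitRegion := by
  intro n _ hnk
  refine mem_zfrSlitRegion_of_im_ne_zero (mem_zfrRegion_of_one_le_re (by simp)) ?_
  simp only [sub_im, add_im, one_im, mul_im, intCast_re, I_im, mul_one, intCast_im, I_re, mul_zero,
    add_zero, zero_add]
  exact_mod_cast sub_ne_zero.2 hnk.symm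

/-- **Modulus of the cofactor**: `‖H_k(s)‖ = Π_{n ≠ k} ‖ζ(s − in)‖^{μ_n} · e^{Re E(s)}`. [folklore] -/
theorem norm_cofactor_le (hf : ∀ n, ‖f n‖ ≤ 1) {k : ℤ} {s : ℂ} (hs34 : 3 / 4 ≤ s.re)
    (hs : ∀ n ∈ S, n ≠ k → s - n * I ∈ zfrRegion) (hs1 : ∀ n ∈ S, n ≠ k → s - n * I ≠ 1) :
    ‖cofactor S μ f A k s‖ ≤
      (∏ n ∈ S.erase k, ‖riemannZeta (s - n * I)‖ ^ (μ n)) *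
        Real.exp ((1 + ∑ n ∈ S, |μ n|) * logRemainderBound + ‖A s‖) := by
  rw [cofactor, norm_mul, norm_prod, norm_exp]
  have hprod : ∏ n ∈ S.erase k, ‖zetaCpow (μ n) (s - n * I)‖ = ∏ n ∈ S.erase k, ‖riemannZeta (s - n * I)‖ ^ (μ n) :=
    Finset.prod_congr rfl fun n hn ↦ norm_zetaCpow (hs n (Finset.mem_of_mem_erase hn) (Finset.ne_of_mem_erase hn))
      (hs1 n (Finset.mem_of_mem_erase hn) (Finset.ne_of_mem_erase hn))
  rw [hprod]
  refine mul_le_mul_of_nonneg_left ?_ (Finset.prod_nonneg fun n _ ↦ Real.rpow_nonneg (norm_nonneg _) _)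
  exact Real.exp_le_exp.2 ((re_le_norm _).trans (norm_harmlessExponent_le hf hs34))

/-! ### The continuation as a single exponential -/

variable (S μ f A)

/-- The logarithm of the continuation off the branch cuts:
`Φ(s) = Σ_{n ∈ S} μ_n (logZeta₁(s − in) − Log(s − in − 1)) + E(s)` (principal `Log`).
[cite: Montgomery1983, §3 (log f*(s) = Σ_k b̂(k) log ζ(s − ik))] -/
def logEulerContinuation (s : ℂ) : ℂ :=
  (∑ n ∈ S, (μ n : ℂ) * (logZeta₁ (s - n * I) - log (s - n * I - 1))) + harmlessExponent S μ f A s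

variable {S μ f A}

/-- `ζ(w)^ν = exp(ν (logZeta₁ w − Log(w − 1)))` for `w ≠ 1`. [folklore] -/
theorem zetaCpow_eq_exp_logZeta₁_sub_log {ν : ℝ} {w : ℂ} (hw : w ≠ 1) :
    zetaCpow ν w = exp (ν * (logZeta₁ w - log (w - 1))) := by
  rw [zetaCpow, cpow_def_of_ne_zero (sub_ne_zero.2 hw), ← exp_add]
  congr 1
  ring

/-- **`G = exp Φ`** off the branch points. [folklore] -/
theorem eulerContinuation_eq_exp {s : ℂ} (hs1 : ∀ n ∈ S, s - n * I ≠ 1) :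
    eulerContinuation S μ f A s = exp (logEulerContinuation S μ f A s) := by
  rw [eulerContinuation, logEulerContinuation, exp_add, shiftedZetaCpowProd, exp_sum]
  congr 1
  refine Finset.prod_congr rfl fun n hn ↦ ?_
  rw [zetaCpow_eq_exp_logZeta₁_sub_log (hs1 n hn)]

/-- Hence `‖G(s)‖ = exp(Re Φ(s))` off the branch points. [folklore] -/
theorem norm_eulerContinuation_eq_exp_re {s : ℂ} (hs1 : ∀ n ∈ S, s - n * I ≠ 1) :
    ‖eulerContinuation S μ f A s‖ = Real.exp (logEulerContinuation S μ f A s).re := by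
  rw [eulerContinuation_eq_exp hs1, norm_exp]

/-- The zeta part `Σ_n μ_n (logZeta₁(s − in) − Log(s − in − 1))` of `Φ` is holomorphic on
`shiftedSlitDomain S`. [folklore] -/
theorem differentiableOn_logZetaPart :
    DifferentiableOn ℂ (fun s : ℂ ↦ ∑ n ∈ S, (μ n : ℂ) * (logZeta₁ (s - n * I) - log (s - n * I - 1)))
      (shiftedSlitDomain S) := by
  refine DifferentiableOn.fun_sum fun n hn ↦ ?_
  intro s hs
  have hsn := hs n hn
  have h1 : DifferentiableAt ℂ (fun s : ℂ ↦ s - n * I) s := by fun_prop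
  have h2 : DifferentiableAt ℂ logZeta₁ (s - n * I) :=
    differentiableOn_logZeta₁.differentiableAt (isOpen_zfrRegion.mem_nhds hsn.1)
  have h3 : DifferentiableAt ℂ (fun s : ℂ ↦ log (s - n * I - 1)) s := by
    have h4 : DifferentiableAt ℂ (fun s : ℂ ↦ s - n * I - 1) s := by fun_prop
    exact h4.clog hsn.2
  exact (((h2.comp s h1).sub h3).const_mul _).differentiableWithinAt

/-- **Holomorphy of `Φ`** on `shiftedSlitDomain S ∩ {Re s > 3/4} ∩ {Re s > σ_A}`. [folklore] -/
theorem differentiableOn_logEulerContinuation (hf : ∀ n, ‖f n‖ ≤ 1) {σA : ℝ}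
    (hA : DifferentiableOn ℂ A {s : ℂ | σA < s.re}) :
    DifferentiableOn ℂ (logEulerContinuation S μ f A)
      (shiftedSlitDomain S ∩ ({s : ℂ | 3 / 4 < s.re} ∩ {s : ℂ | σA < s.re})) := by
  unfold logEulerContinuation
  exact ((differentiableOn_logZetaPart (S := S) (μ := μ)).mono inter_subset_left).add
    ((differentiableOn_harmlessExponent hf hA).mono inter_subset_right)

/-- The derivative of one zeta term: for `w = s − in` in the slit region,
`d/ds [logZeta₁(s − in) − Log(s − in − 1)] = ζ₁'/ζ₁(w) − 1/(w − 1)`. [folklore] -/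
theorem hasDerivAt_logZeta₁_sub_log {n : ℤ} {s : ℂ} (hs : s - n * I ∈ zfrSlitRegion) :
    HasDerivAt (fun s : ℂ ↦ logZeta₁ (s - n * I) - log (s - n * I - 1))
      (deriv riemannZeta₁ (s - n * I) / riemannZeta₁ (s - n * I) - 1 / (s - n * I - 1)) s := by
  have h1 : HasDerivAt (fun s : ℂ ↦ s - n * I) 1 s := (hasDerivAt_id s).sub_const _
  have h2 : HasDerivAt (fun s : ℂ ↦ logZeta₁ (s - n * I))
      (deriv riemannZeta₁ (s - n * I) / riemannZeta₁ (s - n * I) * 1) s :=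
    (hasDerivAt_logZeta₁ hs.1).comp s h1
  have h3 : HasDerivAt (fun s : ℂ ↦ s - n * I - 1) 1 s := ((hasDerivAt_id s).sub_const _).sub_const _
  have h4 : HasDerivAt (fun s : ℂ ↦ log (s - n * I - 1)) (1 / (s - n * I - 1)) s :=
    h3.clog hs.2
  have h5 := h2.sub h4
  simp only [mul_one] at h5
  exact h5

/-- **The zeta part of `Φ'` is `Σ_n μ_n (ζ₁'/ζ₁(s − in) − 1/(s − in − 1))`.** [folklore] -/
theorem hasDerivAt_logZetaPart {s : ℂ} (hs : s ∈ shiftedSlitDomain S) :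
    HasDerivAt (fun s : ℂ ↦ ∑ n ∈ S, (μ n : ℂ) * (logZeta₁ (s - n * I) - log (s - n * I - 1)))
      (∑ n ∈ S, (μ n : ℂ) *
        (deriv riemannZeta₁ (s - n * I) / riemannZeta₁ (s - n * I) - 1 / (s - n * I - 1))) s :=
  HasDerivAt.fun_sum fun n hn ↦ (hasDerivAt_logZeta₁_sub_log (hs n hn)).const_mul _

/-- **Bound for the zeta part of `Φ'`** in the region:
`‖Σ_n μ_n (ζ₁'/ζ₁(s − in) − 1/(s − in − 1))‖ ≤ Σ_n |μ_n| (C log(|Im s − n| + 3) + 1/‖s − in − 1‖)`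
(`C = zfrBoundConst`; `ζ₁'/ζ₁(w) = ζ'/ζ(w) + 1/(w − 1)` and Titchmarsh (3.11.8)).
[cite: Titchmarsh1986, Theorem 3.11] -/
theorem norm_logZetaPart_deriv_le {s : ℂ} (hs : ∀ n ∈ S, s - n * I ∈ zfrRegion)
    (hs1 : ∀ n ∈ S, s - n * I ≠ 1) :
    ‖∑ n ∈ S, (μ n : ℂ) *
        (deriv riemannZeta₁ (s - n * I) / riemannZeta₁ (s - n * I) - 1 / (s - n * I - 1))‖ ≤
      ∑ n ∈ S, |μ n| * (zfrBoundConst * Real.log (|s.im - n| + 3) + 1 / ‖s - n * I - 1‖) := by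
  refine (norm_sum_le _ _).trans (Finset.sum_le_sum fun n hn ↦ ?_)
  set w : ℂ := s - n * I with hw
  have hw1 : w ≠ 1 := hs1 n hn
  have hw1' : w - 1 ≠ 0 := sub_ne_zero.2 hw1
  have hζ : riemannZeta w ≠ 0 := riemannZeta_ne_zero_of_mem_zfrRegion (hs n hn) hw1
  -- `ζ₁'/ζ₁(w) − 1/(w − 1) = ζ'/ζ(w) = (ζ'/ζ(w) + 1/(w−1)) − 1/(w−1)`
  have hid : deriv riemannZeta₁ w / riemannZeta₁ w - 1 / (w - 1) =
      (deriv riemannZeta w / riemannZeta w + 1 / (w - 1)) - 1 / (w - 1) := by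
    rw [ZetaOneLine.deriv_riemannZeta₁_eq hw1, riemannZeta₁_eq_mul hw1]
    field_simp
    ring
  have him : w.im = s.im - n := by simp [hw]
  rw [norm_mul, norm_real, Real.norm_eq_abs, hid]
  refine mul_le_mul_of_nonneg_left ?_ (abs_nonneg _)
  calc ‖deriv riemannZeta w / riemannZeta w + 1 / (w - 1) - 1 / (w - 1)‖
      ≤ ‖deriv riemannZeta w / riemannZeta w + 1 / (w - 1)‖ + ‖1 / (w - 1)‖ := norm_sub_le _ _
    _ ≤ zfrBoundConst * Real.log (|s.im - n| + 3) + 1 / ‖s - n * I - 1‖ := by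
        rw [norm_div, norm_one, ← him]
        exact add_le_add (zfr_bounds hw1 (le_of_lt (hs n hn))).2.2.2 le_rfl

end Literature.NumberTheory.LFunctions

end
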